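import Summits.HodgeConjecture.HodgeConjecture.Theorems.SixfoldTableXCensusSexticGeneralRow
import Literature.AlgebraicGeometry.HodgeTheory.CMFieldThreeTwoMixedHodgeLie
import Literature.AlgebraicGeometry.HodgeTheory.NoWeilTypeHodgeTraceDictionary
import HarnessLib

/-!
# TABLE X (dimension 6) — row 10 `g6.IV(2,1)` (`End⁰ = E` a QUARTIC CM field, `dim_E H¹ = 3`), the members of CM PATTERN
# `(2,1)+(2,1)` / `(2,1)+(1,2)` NOT OF WEIL TYPE: the census nodes X2 / X1 DISCHARGED IN THE KERNEL on the whole isogeny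
# class, `hU` of L14 REDUCED to the displayed geometric no-Weil-type datum `hnW` (Moonen–Zarhin 1999 (2.3); Ribet 1983 Thm. 0)
# — cell `pub-hodgeav-hg6`, req-37 (A) Q2b, eng-5 g7

HONEST FRAMING. HC, `HC_AV` (stmt-1333), `HC_CM` (stmt-3052) and the rung H2 are NOT proved and do not occur here. The
census nodes `TableX.SixfoldCodimTwoCensus` (X2) / `TableX.SixfoldCodimThreeCensus` (X1) of `SixfoldTableXCover` are OURS
(`@[conjecture]`), never asserted — they quantify over ALL off-residue sixfolds; here they are DISCHARGED on one isogeny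
class per hypothesis set. KERNEL ONLY: theorems over existing declarations; no definition, no `sorry`, no named fact; the
only displayed hypothesis is the class-defining geometric datum `hnW` («`B` is not of Weil type relative to any
`β ∈ End(B)` with `β ≫ β = −d`, `d > 0`»), in the tree's Weil-type vocabulary; typed ≠ proved.

WHY THIS MODULE (census-node self-audit, axis A7 «a row VERIFIED in the kernel, not by dossier», continued). L14
(`SixfoldTableXCensusQuarticGeneralRow`, eng-4 g5) put row 10 on A7 for the GENERAL member with the Lie hypothesis `hU`
(«every `(φ^*)_ℂ`-commuting `ψ_ℂ`-skew operator of `H¹(B(ℂ); ℂ)` lies in `Lie Hg(H¹(B)) ⊗ ℂ`», i.e. `Hg(B) = U_E(V,ψ)`)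
DISPLAYED; the companion module `SixfoldTableXCensusQuarticOneScalarAllMembers` discharged it for the pattern `(3,0)+(2,1)`.
For the remaining patterns `(2,1)+(2,1)` / `(2,1)+(1,2)` (BOTH places mixed) `hU` is FALSE on the Weil-type members (`E ⊇ k`
imaginary quadratic acting `(3,3)`: `Hg ⊆ SU_k`, TABLE X row 11) and TRUE off them: the cell's U-programme (eng-5 g6/g7: socket
`CMThetaSocket.*`, centre `CMThetaCentre.centre_of_pair`, envelope `CMTwist.*`, no-twist `CMNoTwist3.lift_of_two_mixed`,
irreducibility `CMIrred.*`, assembly `CMThetaThreeTwoMixed.*`, dictionary `AbelianVariety.hodgeLieC_of_cmField_threeTwoMixed`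
+ `AbelianVariety.trace_mul_theta_ne_zero_of_noWeilType`) PROVES `hU` for every SIMPLE `B` with `dim_ℚ End⁰(B) = 4`,
`φ ∈ End(B)` with four pairwise non-conjugate eigenvalues of pair multiplicity `3`, both places mixed, under the displayed
geometric `hnW`. THIS FILE is L14/L15's §1–§2 with `hU` so REDUCED — nothing of L14 / L15 / L10 / G2 is restated, only applied:
* §1 `census_of_isIsogenous_cmField_threeTwoMixed` — both census conclusions X2-at-`A`, X1-at-`A` at every `A ∼ B`
  (any `ι` with `|ι| ≤ 2`, `dim B = 3|ι|`); `hodgeConjectureFor_of_isIsogenous_cmField_threeTwoMixed` — L6's CONCLUSION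
  `HodgeConjectureFor` on the whole isogeny class, under the displayed `hnW` only.
* §2 `census_row10_quartic_threeTwoMixed` — TABLE X row 10, PATTERNS `(2,1)+(2,1)` / `(2,1)+(1,2)`, ALL MEMBERS NOT OF
  WEIL TYPE, KERNEL VERDICT: every `A ∼ B` is IN THE NODES' DOMAIN (`dim A = 6 ∧ ¬ 𝒞 A`: the hU-free half) AND satisfies
  X2-at-`A` ∧ X1-at-`A`; `census_row10_quartic_threeTwoMixed_self`.

READING (honest scope). With `SixfoldTableXCensusQuarticOneScalarAllMembers` ((3,0)+(2,1), unconditional) and this file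
((2,1)+(2,1) / (2,1)+(1,2), under `hnW`), EVERY member of row 10 that is not of Weil type is on A7; the Weil-type members are
TABLE X row 11 (`Hg = SU`-type, not this route). HC / HC_AV are NOT proved beyond these isogeny-class statements' own
content; X2 / X1 stay `@[conjecture]` globally. No inhabitant is exhibited and none is invented here.

All declarations live in the sub-namespace `TableX.TypeIVRows` (lead g2 DEDUP RULE: import the entry points, restate
nothing). Nothing here is a corollary of `HC_CM`; typed ≠ proved.
-/

set_option linter.dupNamespace false

noncomputable section

open scoped TensorProduct
open CategoryTheory
open Literature.AlgebraicGeometry Literature.AlgebraicGeometry.Motives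
open Literature.AlgebraicGeometry.Motives.AbelianVariety (IsIsogenous IsSimple)
open Literature.AlgebraicGeometry.HodgeTheory
open Literature.AlgebraicGeometry.Milne1999
open Literature.AlgebraicTopology.SingularHomology
open Literature.Barriers.HodgeConjecture
open Summit.HodgeConjecture.HodgeConjecture.Ring2.ClassTargets
open Summit.HodgeConjecture.HodgeConjecture.Ring2.Motiv (ProdCMCell)
open Summit.HodgeConjecture.HodgeConjecture.Ring2.Atlas (IsQuarticFieldTypeIVFourfold)
open Summit.HodgeConjecture.HodgeConjecture.TableX.SimpleRows

namespace Summit.HodgeConjecture.HodgeConjecture.TableX.TypeIVRows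

/-! ## §1 CM field of degree `2|ι| ≤ 4`, multiplicity `3`, two mixed places, not of Weil type: both census conclusions and
`HodgeConjectureFor` on the isogeny class, `hU` reduced to the displayed geometric `hnW` -/

/-- **Both census conclusions X2-at-`A`, X1-at-`A` at every `A` isogenous to a SIMPLE complex abelian variety `B` with
`dim_ℚ End⁰(B) = 2|ι|` (`|ι| ≤ 2`), `φ ∈ End(B)` with colours `μ : ι → ℂ` of pair multiplicity `3`, `dim B = 3|ι|`, two places
`k₁ ≠ k₂`, every place mixed, `B` NOT OF WEIL TYPE relative to any `β ∈ End(B)` with `β ≫ β = −d`, `d > 0` (the displayed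
`hnW`)** — L15's `census_of_isIsogenous_cmFieldGeneral` with its displayed Lie hypothesis `hU` supplied by
`AbelianVariety.hodgeLieC_of_cmField_threeTwoMixed` and the dictionary `AbelianVariety.trace_mul_theta_ne_zero_of_noWeilType` (the polarization of `H¹(B(ℂ); ℚ)` and the Betti-universe
facts supplied by the tree's `smoothProjective_hodgeStructure_isPolarizable_holds`, `exists_isReal_hodgeModel_holds`,
`hodgePQ_independent_of_hodgeModel_holds`). HC ∕ HC_AV NOT proved; X2 ∕ X1 stay `@[conjecture]` globally.
[cite: MoonenZarhin1999LowDim, §1 (1.8), §2 (2.3)] [cite: Ribet1983, Thm. 0] [cite: vanGeemen1994HodgeAV, §2.4 and Lemma 3.7]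
[cite: MumfordAV1970, §19 Cor. 2 of Thm. 1 (p. 174)] -/
theorem census_of_isIsogenous_cmField_threeTwoMixed {ι : Type} [Fintype ι] [DecidableEq ι] (hι : Fintype.card ι ≤ 2)
    {A B : AbelianVariety ℂ} (hBs : B.IsSimple) (φ : B ⟶ B)
    (hE : Module.finrank ℚ B.endAlgebra = 2 * Fintype.card ι) (μ : ι → ℂ) (hinj : Function.Injective μ)
    (hdist : ∀ k k', μ k' ≠ starRingEnd ℂ (μ k))
    (hmult : ∀ k, eigenMultiplicity B φ (μ k) + eigenMultiplicity B φ (starRingEnd ℂ (μ k)) = 3)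
    (hdim : B.dim = Fintype.card ι * 3)
    (hmix : ∀ k, eigenMultiplicity B φ (μ k) ≠ 0 ∧ eigenMultiplicity B φ (starRingEnd ℂ (μ k)) ≠ 0)
    (k₁ k₂ : ι) (hk₁₂ : k₁ ≠ k₂)
    (hnW : ∀ (d : ℕ) (β : B ⟶ B), 0 < d → β ≫ β = -(d • 𝟙 B) →
      eigenMultiplicity B β (Complex.I * (Real.sqrt d : ℂ)) ≠ eigenMultiplicity B β (-(Complex.I * (Real.sqrt d : ℂ))))
    (hAB : IsIsogenous A B) :
    (∀ c : complexBetti A.X (2 * 2), IsRationalClass c → IsOfHodgeType A.dim A.X (2 * 2) 2 2 c →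
      c ∈ divisorClassesSpan A.X A.dim 2 ⊔ Submodule.span ℂ {w' : complexBetti A.X (2 * 2) |
        ∃ (C : AbelianVariety ℂ) (g : A.X ⟶ C.X) (w : complexBetti C.X (2 * 2)), C.dim < A.dim ∧
          IsRationalClass w ∧ IsOfHodgeType C.dim C.X (2 * 2) 2 2 w ∧ w' = complexBetti.map g (2 * 2) w}) ∧
    (∀ c : complexBetti A.X (2 * 3), IsRationalClass c → IsOfHodgeType A.dim A.X (2 * 3) 3 3 c →
      c ∈ divisorClassesSpan A.X A.dim 3 ⊔ Submodule.span ℂ {w' : complexBetti A.X (2 * 3) |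
          ∃ (a : complexBetti A.X (2 * 2)) (b : complexBetti A.X (2 * 1)),
            IsRationalClass a ∧ IsOfHodgeType A.dim A.X (2 * 2) 2 2 a ∧ IsRationalClass b ∧
            IsOfHodgeType A.dim A.X (2 * 1) 1 1 b ∧ w' = cupProduct (two_mul_add_two_mul 2 1) a b} ⊔
        Submodule.span ℂ {w' : complexBetti A.X (2 * 3) |
          ∃ (C : AbelianVariety ℂ) (g : A.X ⟶ C.X) (w : complexBetti C.X (2 * 3)), C.dim < A.dim ∧
            IsRationalClass w ∧ IsOfHodgeType C.dim C.X (2 * 3) 3 3 w ∧ w' = complexBetti.map g (2 * 3) w} ⊔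
        Submodule.span ℂ {w' : complexBetti A.X (2 * 3) |
          ∃ (B' : AbelianVariety ℂ) (g : A.X ⟶ B'.X) (d : ℕ) (ψ : B' ⟶ B') (w : complexBetti B'.X (2 * 3)),
            B'.dim = 6 ∧ 0 < d ∧ ψ ≫ ψ = -(d • 𝟙 B') ∧ IsRationalClass w ∧
            IsOfHodgeType B'.dim B'.X (2 * 3) 3 3 w ∧ w ∈ weilClassesOf B' ψ 3 d ∧
            w' = complexBetti.map g (2 * 3) w}) := by
  have hHD : exists_isReal_hodgeModel := exists_isReal_hodgeModel_holds
  have hI : hodgePQ_independent_of_hodgeModel := hodgePQ_independent_of_hodgeModel_holds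
  haveI : HodgeTensorFacts.{0, 0} := hodgeTensorFacts_holds.{0, 0}
  have hX : IsSmoothProjective B.dim B.X := AbelianVariety.isSmoothProjective_holds
  obtain ⟨ψ⟩ : (BettiUniverse.hodge hHD (AbelianVariety.isSmoothProjective_holds (A := B)) 1).IsPolarizable :=
    smoothProjective_hodgeStructure_isPolarizable_holds hX (BettiUniverse.realHodgeModel hHD hX)
      (BettiUniverse.realHodgeModel_isHodgeSymmetric hHD hX) 1
  exact census_of_isIsogenous_cmFieldGeneral φ hE μ hinj hdist zero_lt_three hmult hdim hHD hI ψ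
    (AbelianVariety.hodgeLieC_of_cmField_threeTwoMixed hι B hBs φ hE μ hinj hdist hmult hdim hmix k₁ k₂ hk₁₂ hHD hI ψ
      (AbelianVariety.trace_mul_theta_ne_zero_of_noWeilType B hHD hI ψ hnW)) hAB

/-- **L6's CONCLUSION on the isogeny class under the displayed `hnW`: the Hodge conjecture holds for every complex abelian
variety isogenous to a SIMPLE `B` with `dim_ℚ End⁰(B) = 2|ι|` (`|ι| ≤ 2`), `φ ∈ End(B)` of pair multiplicity `3`, `dim B = 3|ι|`,
two mixed places, and `B` not of Weil type relative to any `β ∈ End(B)`, `β ≫ β = −d`** (L15's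
`hodgeConjectureFor_of_isIsogenous_cmFieldGeneral` with `hU` supplied by `AbelianVariety.hodgeLieC_of_cmField_threeTwoMixed` and
`AbelianVariety.trace_mul_theta_ne_zero_of_noWeilType`). `hnW` is displayed, never discharged.
None of Markman₄ / Markman₆ / R-W6 / X2 / X1 / `HC_CM` enters. HC ∕ HC_AV NOT proved beyond this statement's own content.
[cite: MoonenZarhin1999LowDim, §1 (1.7)–(1.8) and §2 (2.3)] [cite: Ribet1983, Thm. 0] [cite: vanGeemen1994HodgeAV, §2.4 and Lemma 3.7] -/
theorem hodgeConjectureFor_of_isIsogenous_cmField_threeTwoMixed {ι : Type} [Fintype ι] [DecidableEq ι]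
    (hι : Fintype.card ι ≤ 2)
    {A B : AbelianVariety ℂ} (hBs : B.IsSimple) (φ : B ⟶ B)
    (hE : Module.finrank ℚ B.endAlgebra = 2 * Fintype.card ι) (μ : ι → ℂ) (hinj : Function.Injective μ)
    (hdist : ∀ k k', μ k' ≠ starRingEnd ℂ (μ k))
    (hmult : ∀ k, eigenMultiplicity B φ (μ k) + eigenMultiplicity B φ (starRingEnd ℂ (μ k)) = 3)
    (hdim : B.dim = Fintype.card ι * 3)
    (hmix : ∀ k, eigenMultiplicity B φ (μ k) ≠ 0 ∧ eigenMultiplicity B φ (starRingEnd ℂ (μ k)) ≠ 0)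
    (k₁ k₂ : ι) (hk₁₂ : k₁ ≠ k₂)
    (hnW : ∀ (d : ℕ) (β : B ⟶ B), 0 < d → β ≫ β = -(d • 𝟙 B) →
      eigenMultiplicity B β (Complex.I * (Real.sqrt d : ℂ)) ≠ eigenMultiplicity B β (-(Complex.I * (Real.sqrt d : ℂ))))
    (hAB : IsIsogenous A B) : HodgeConjectureFor A.dim A.X := by
  have hHD : exists_isReal_hodgeModel := exists_isReal_hodgeModel_holds
  have hI : hodgePQ_independent_of_hodgeModel := hodgePQ_independent_of_hodgeModel_holds
  haveI : HodgeTensorFacts.{0, 0} := hodgeTensorFacts_holds.{0, 0}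
  have hX : IsSmoothProjective B.dim B.X := AbelianVariety.isSmoothProjective_holds
  obtain ⟨ψ⟩ : (BettiUniverse.hodge hHD (AbelianVariety.isSmoothProjective_holds (A := B)) 1).IsPolarizable :=
    smoothProjective_hodgeStructure_isPolarizable_holds hX (BettiUniverse.realHodgeModel hHD hX)
      (BettiUniverse.realHodgeModel_isHodgeSymmetric hHD hX) 1
  exact hodgeConjectureFor_of_isIsogenous_cmFieldGeneral φ hE μ hinj hdist zero_lt_three hmult hdim hHD hI ψ
    (AbelianVariety.hodgeLieC_of_cmField_threeTwoMixed hι B hBs φ hE μ hinj hdist hmult hdim hmix k₁ k₂ hk₁₂ hHD hI ψ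
      (AbelianVariety.trace_mul_theta_ne_zero_of_noWeilType B hHD hI ψ hnW)) hAB

/-! ## §2 TABLE X row 10 `g6.IV(2,1)`, CM patterns `(2,1)+(2,1)` / `(2,1)+(1,2)`, ALL MEMBERS NOT OF WEIL TYPE: kernel verdict
with domain membership -/

/-- **TABLE X ROW 10 `g6.IV(2,1)`, CM PATTERNS `(2,1)+(2,1)` / `(2,1)+(1,2)`, ALL MEMBERS NOT OF WEIL TYPE — KERNEL VERDICT on
the whole isogeny class, `hU` reduced to the displayed geometric `hnW`.** For a SIMPLE complex abelian SIXFOLD `B` with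
`dim_ℚ End⁰(B) = 4`, `φ ∈ End(B)` with colours `μ : Fin 2 → ℂ` (injective, none conjugate to another or itself) of pair
multiplicity `3` — so `E = End⁰(B) = ℚ(φ)` is a quartic CM field with `dim_E H¹(B;ℚ) = 3` — both places MIXED, and `B` not of
Weil type relative to any `β ∈ End(B)` with `β ≫ β = −d`, `d > 0`; then for every `A` isogenous to `B`: `dim A = 6` and `A`
is OFF the residue class `𝒞`, AND both census conclusions X2-at-`A`, X1-at-`A` hold (§1 at `ι = Fin 2`). This is L14's
`census_row10_quarticGeneral` with `hU` REDUCED to `hnW` for these patterns: these members of row 10 join A7 («Hg = U_E» is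
a kernel theorem for them, modulo the displayed class-defining `hnW`). SHARP: the Weil-type members have `Hg ⊆ SU_k ⊊ U_E`
(TABLE X row 11). HC ∕ HC_AV NOT proved; X2 ∕ X1 stay `@[conjecture]` globally. [cite: MoonenZarhin1999LowDim, §1 (1.8), §2 (2.3) and §5 (5.1)]
[cite: Ribet1983, Thm. 0] [cite: vanGeemen1994HodgeAV, Lemma 3.7] [cite: MumfordAV1970, §19 Cor. 2 of Thm. 1 (p. 174)] [cite: Milne1999, §2 p. 54] -/
theorem census_row10_quartic_threeTwoMixed {A B : AbelianVariety ℂ} (hB : B.dim = 6) (hBs : B.IsSimple) (φ : B ⟶ B)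
    (hE4 : Module.finrank ℚ B.endAlgebra = 4) (μ : Fin 2 → ℂ) (hinj : Function.Injective μ)
    (hdist : ∀ k k', μ k' ≠ starRingEnd ℂ (μ k))
    (hmult : ∀ k, eigenMultiplicity B φ (μ k) + eigenMultiplicity B φ (starRingEnd ℂ (μ k)) = 3)
    (hmix : ∀ k, eigenMultiplicity B φ (μ k) ≠ 0 ∧ eigenMultiplicity B φ (starRingEnd ℂ (μ k)) ≠ 0)
    (hnW : ∀ (d : ℕ) (β : B ⟶ B), 0 < d → β ≫ β = -(d • 𝟙 B) →
      eigenMultiplicity B β (Complex.I * (Real.sqrt d : ℂ)) ≠ eigenMultiplicity B β (-(Complex.I * (Real.sqrt d : ℂ))))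
    (hAB : IsIsogenous A B) :
    (A.dim = 6 ∧ ¬ (IsOfCMType A ∨ ProdCMCell IsQuarticFieldTypeIVFourfold (fun Z ↦ Z.dim = 2) A)) ∧
    (∀ c : complexBetti A.X (2 * 2), IsRationalClass c → IsOfHodgeType A.dim A.X (2 * 2) 2 2 c →
      c ∈ divisorClassesSpan A.X A.dim 2 ⊔ Submodule.span ℂ {w' : complexBetti A.X (2 * 2) |
        ∃ (C : AbelianVariety ℂ) (g : A.X ⟶ C.X) (w : complexBetti C.X (2 * 2)), C.dim < A.dim ∧
          IsRationalClass w ∧ IsOfHodgeType C.dim C.X (2 * 2) 2 2 w ∧ w' = complexBetti.map g (2 * 2) w}) ∧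
    (∀ c : complexBetti A.X (2 * 3), IsRationalClass c → IsOfHodgeType A.dim A.X (2 * 3) 3 3 c →
      c ∈ divisorClassesSpan A.X A.dim 3 ⊔ Submodule.span ℂ {w' : complexBetti A.X (2 * 3) |
          ∃ (a : complexBetti A.X (2 * 2)) (b : complexBetti A.X (2 * 1)),
            IsRationalClass a ∧ IsOfHodgeType A.dim A.X (2 * 2) 2 2 a ∧ IsRationalClass b ∧
            IsOfHodgeType A.dim A.X (2 * 1) 1 1 b ∧ w' = cupProduct (two_mul_add_two_mul 2 1) a b} ⊔
        Submodule.span ℂ {w' : complexBetti A.X (2 * 3) |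
          ∃ (C : AbelianVariety ℂ) (g : A.X ⟶ C.X) (w : complexBetti C.X (2 * 3)), C.dim < A.dim ∧
            IsRationalClass w ∧ IsOfHodgeType C.dim C.X (2 * 3) 3 3 w ∧ w' = complexBetti.map g (2 * 3) w} ⊔
        Submodule.span ℂ {w' : complexBetti A.X (2 * 3) |
          ∃ (B' : AbelianVariety ℂ) (g : A.X ⟶ B'.X) (d : ℕ) (ψ : B' ⟶ B') (w : complexBetti B'.X (2 * 3)),
            B'.dim = 6 ∧ 0 < d ∧ ψ ≫ ψ = -(d • 𝟙 B') ∧ IsRationalClass w ∧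
            IsOfHodgeType B'.dim B'.X (2 * 3) 3 3 w ∧ w ∈ weilClassesOf B' ψ 3 d ∧
            w' = complexBetti.map g (2 * 3) w}) :=
  ⟨offResidueSix_of_isIsogenous_of_isSimple_of_not_isOfCMType hAB hB hBs
      (not_isOfCMType_of_finrank_endAlgebra_lt_two_mul_dim (by omega)),
    census_of_isIsogenous_cmField_threeTwoMixed (by rw [Fintype.card_fin]) hBs φ (by rw [hE4, Fintype.card_fin]) μ hinj
      hdist hmult (by rw [hB, Fintype.card_fin]) hmix 0 1 Fin.zero_ne_one hnW hAB⟩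

/-- **Row 10, CM patterns `(2,1)+(2,1)` / `(2,1)+(1,2)`, the model itself**: `B` is in the nodes' domain and satisfies X2-at-`B`
∧ X1-at-`B`, under the displayed geometric `hnW` (the case `A = B` of `census_row10_quartic_threeTwoMixed`). HC ∕ HC_AV NOT
proved. [cite: MoonenZarhin1999LowDim, §1 (1.8) and §2 (2.3)] [cite: Ribet1983, Thm. 0] -/
theorem census_row10_quartic_threeTwoMixed_self {B : AbelianVariety ℂ} (hB : B.dim = 6) (hBs : B.IsSimple) (φ : B ⟶ B)
    (hE4 : Module.finrank ℚ B.endAlgebra = 4) (μ : Fin 2 → ℂ) (hinj : Function.Injective μ)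
    (hdist : ∀ k k', μ k' ≠ starRingEnd ℂ (μ k))
    (hmult : ∀ k, eigenMultiplicity B φ (μ k) + eigenMultiplicity B φ (starRingEnd ℂ (μ k)) = 3)
    (hmix : ∀ k, eigenMultiplicity B φ (μ k) ≠ 0 ∧ eigenMultiplicity B φ (starRingEnd ℂ (μ k)) ≠ 0)
    (hnW : ∀ (d : ℕ) (β : B ⟶ B), 0 < d → β ≫ β = -(d • 𝟙 B) →
      eigenMultiplicity B β (Complex.I * (Real.sqrt d : ℂ)) ≠ eigenMultiplicity B β (-(Complex.I * (Real.sqrt d : ℂ)))) :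
    (B.dim = 6 ∧ ¬ (IsOfCMType B ∨ ProdCMCell IsQuarticFieldTypeIVFourfold (fun Z ↦ Z.dim = 2) B)) ∧
    (∀ c : complexBetti B.X (2 * 2), IsRationalClass c → IsOfHodgeType B.dim B.X (2 * 2) 2 2 c →
      c ∈ divisorClassesSpan B.X B.dim 2 ⊔ Submodule.span ℂ {w' : complexBetti B.X (2 * 2) |
        ∃ (C : AbelianVariety ℂ) (g : B.X ⟶ C.X) (w : complexBetti C.X (2 * 2)), C.dim < B.dim ∧
          IsRationalClass w ∧ IsOfHodgeType C.dim C.X (2 * 2) 2 2 w ∧ w' = complexBetti.map g (2 * 2) w}) ∧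
    (∀ c : complexBetti B.X (2 * 3), IsRationalClass c → IsOfHodgeType B.dim B.X (2 * 3) 3 3 c →
      c ∈ divisorClassesSpan B.X B.dim 3 ⊔ Submodule.span ℂ {w' : complexBetti B.X (2 * 3) |
          ∃ (a : complexBetti B.X (2 * 2)) (b : complexBetti B.X (2 * 1)),
            IsRationalClass a ∧ IsOfHodgeType B.dim B.X (2 * 2) 2 2 a ∧ IsRationalClass b ∧
            IsOfHodgeType B.dim B.X (2 * 1) 1 1 b ∧ w' = cupProduct (two_mul_add_two_mul 2 1) a b} ⊔
        Submodule.span ℂ {w' : complexBetti B.X (2 * 3) |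
          ∃ (C : AbelianVariety ℂ) (g : B.X ⟶ C.X) (w : complexBetti C.X (2 * 3)), C.dim < B.dim ∧
            IsRationalClass w ∧ IsOfHodgeType C.dim C.X (2 * 3) 3 3 w ∧ w' = complexBetti.map g (2 * 3) w} ⊔
        Submodule.span ℂ {w' : complexBetti B.X (2 * 3) |
          ∃ (B' : AbelianVariety ℂ) (g : B.X ⟶ B'.X) (d : ℕ) (ψ : B' ⟶ B') (w : complexBetti B'.X (2 * 3)),
            B'.dim = 6 ∧ 0 < d ∧ ψ ≫ ψ = -(d • 𝟙 B') ∧ IsRationalClass w ∧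
            IsOfHodgeType B'.dim B'.X (2 * 3) 3 3 w ∧ w ∈ weilClassesOf B' ψ 3 d ∧
            w' = complexBetti.map g (2 * 3) w}) :=
  census_row10_quartic_threeTwoMixed hB hBs φ hE4 μ hinj hdist hmult hmix hnW (IsIsogenous.refl B)

end Summit.HodgeConjecture.HodgeConjecture.TableX.TypeIVRows

end
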